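import Literature.MathematicalPhysics.QuantumLattice.FermiRG.FSTInversionIteration
import Literature.MathematicalPhysics.QuantumLattice.FermiRG.FSTInversionScaleSums
import HarnessLib

/-!
# Feldman–Salmhofer–Trubowitz IV — Theorem 3 (scale bounds) ⇒ the hypotheses of the iteration
# theorem (Theorem 2 (1)–(2)), assembled — PROOF (glue)

J. Feldman, M. Salmhofer, E. Trubowitz, *An inversion theorem in Fermi surface theory*, CPAM **53**
(2000) 1350–1384 = arXiv:math-ph/0001031 [FeldmanSalmhoferTrubowitz2000]; render
`paper:arxiv-math-ph_0001031`, locators `p.N:Ln`.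

`FermiRG/FSTInversionScaleSums.lean` proves, scale sum by scale sum, that the bounds of Theorem 3
(p.9:L139–185) imply (r1), (dr1), (dr2), (dr3) of Theorem 2 (p.9:L190–p.10:L90);
`FermiRG/FSTInversionIteration.lean` proves Theorem 2 (3)–(4) from the hypothesis record
`FST4.IterationBounds` (= Theorem 2 (1)–(2)).  This file composes the two: for a family of scale maps
`K_j` (`j < 0`, re-indexed by `ℕ`) obeying Theorem 3 on the ball `B_ε^{(2)}(E)` and the FST I input
(dr0) ("(dr0) was proven in I (Theorem I.3.5)", p.9:L191–192) for `K = Σ_j K_j`, the map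
`K(e) = Σ_j K_j(e)` satisfies `IterationBounds` with `δ = ε̃/4` and any constants `D, Q₀, Q₁ ≥ 1`
dominating the printed ones (`D_R = Q̃M^{−ε̃}/(1−M^{−ε̃})`, `3Q̃̃`, `3Q₄`, `Q₄`; p.9:L191, p.10:L7,
L70).  The single exponent `δ = ε̃/4` (Theorem 2 (2) prints one `δ`; its proof produces `ε̃/3` for
(dr1) and `ε̃/4` for (dr2)) is obtained from `|e₁−e₀|₀ ≤ 1` on the ball, for which we assume
`ε ≤ 1/2` (Lemma 2's `ε` may be shrunk).  Consequently (`iterationBounds_of_scaleBounds` +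
`deltasatz_existence`) Theorem 2 (3)'s conclusion holds for `K = Σ_j K_j` under Theorem 3's bounds —
FST IV §3 modulo its §4 input, FST I Thm 3.5 and Lemma 2.  Nothing is asserted about the FST
counterterm (GAP G-t5-1 of the gate-hubbard-kl wave).  No definition, no `sorry`, net fact debt 0.
-/

noncomputable section

open Filter Topology

namespace Literature.MathematicalPhysics.QuantumLattice.FermiRG

namespace FST4

variable {X : Type*} [NormedAddCommGroup X] [NormedSpace ℝ X] [CompleteSpace X]

/-- **Theorem 3 ⇒ Theorem 2 (1)–(2), assembled.**  Data: seminorms `N0 ≤ N1 ≤ N2 ≤ ‖·‖`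
(`NormLadder`), scale maps `Kj : ℕ → X → X` (`Kj j' = K^{(R)}_j(·,λV)`, `j = −(j'+1)`), `m = 1/M ∈ (0,1)`,
`0 < ε̃ < 1`, `Q̃ ≥ 0`, on the ball `B_ε^{(2)}(E)`, `ε ≤ 1/2`:
(line1) `‖K_j(e)‖ ≤ Q̃|λ|M^{ε̃j}`; (line3) `|K_j(e₁)−K_j(e₀)|₁ ≤ Q̃|λ|(M^{−1.1j}|f|₀ + M^{ε̃j}|f|₁)`;
(line4) `|K_j(e₁)−K_j(e₀)|_{3,r} ≤ Q̃|λ|(M^{−2.1j}|f|₁ + M^{ε̃j}(S₃|f|₀ + |f|₂))` for every `S₃` bounding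
`|e_t|_{3,r}`, `t ∈ [0,1]` (p.9:L149–176); and (dr0) for `K = Σ_j K_j` with a constant `Q₀₀` (FST I
Thm 3.5).  Conclusion: `IterationBounds N0 N1 N2 K E ε (ε̃/4) λ D Q₀ Q₁` for `K e = Σ' K_j e` and all
`D, Q₀, Q₁ ≥ 1` with `D ≥ Q̃ m^{ε̃}/(1−m^{ε̃})`, `Q₀ ≥ Q₀₀`, `Q₀ ≥ 3Q̃/(1−m^{ε'₁})`, `Q₀ ≥ 3Q̃/(1−m^{ε'₂})`,
`Q₁ ≥ Q̃/(1−m^{ε'₂})`, `ε'₁ = min{0.2, ε̃/3}`, `ε'₂ = min{0.15, ε̃/4}` (p.9:L190–p.10:L90).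
[cite: FeldmanSalmhoferTrubowitz2000, Thm 2 (1)-(2) from Thm 3 p.9:L186-p.10:L90] -/
theorem iterationBounds_of_scaleBounds {N0 N1 N2 : Seminorm ℝ X} (hN : NormLadder N0 N1 N2)
    {Kj : ℕ → X → X} {E : X} {ε m εt Qt lam Q00 D Q0 Q1 : ℝ}
    (hm : 0 < m) (hm1 : m < 1) (hεt : 0 < εt) (hεt1 : εt < 1) (hQt : 0 ≤ Qt) (hε : ε ≤ 1 / 2)
    (line1 : ∀ e, N2 (e - E) < ε → ∀ j, ‖Kj j e‖ ≤ Qt * |lam| * (m ^ εt) ^ (j + 1))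
    (line3 : ∀ e₀ e₁, N2 (e₀ - E) < ε → N2 (e₁ - E) < ε → ∀ j,
      N1 (Kj j e₁ - Kj j e₀) ≤ Qt * |lam| *
        ((m ^ (-(11 / 10 : ℝ))) ^ (j + 1) * N0 (e₁ - e₀) + (m ^ εt) ^ (j + 1) * N1 (e₁ - e₀)))
    (line4 : ∀ e₀ e₁ (S : ℝ), N2 (e₀ - E) < ε → N2 (e₁ - E) < ε →
      (∀ t ∈ Set.Icc (0 : ℝ) 1, ‖(1 - t) • e₀ + t • e₁‖ ≤ S) → ∀ j,
      ‖Kj j e₁ - Kj j e₀‖ ≤ Qt * |lam| *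
        ((m ^ (-(21 / 10 : ℝ))) ^ (j + 1) * N1 (e₁ - e₀) +
          (m ^ εt) ^ (j + 1) * (S * N0 (e₁ - e₀) + N2 (e₁ - e₀))))
    (dr0 : ∀ e₀ e₁, N2 (e₀ - E) < ε → N2 (e₁ - E) < ε →
      N0 ((∑' j, Kj j e₁) - ∑' j, Kj j e₀) ≤ Q00 * |lam| * N0 (e₁ - e₀))
    (hD1 : 1 ≤ D) (hD : Qt * (m ^ εt / (1 - m ^ εt)) ≤ D)
    (hQ01 : 1 ≤ Q0) (hQ0a : Q00 ≤ Q0)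
    (hQ0b : 3 * (Qt * (1 / (1 - m ^ min (1 / 5 : ℝ) (εt / 3)))) ≤ Q0)
    (hQ0c : 3 * (Qt * (1 / (1 - m ^ min (3 / 20 : ℝ) (εt / 4)))) ≤ Q0)
    (hQ11 : 1 ≤ Q1) (hQ1 : Qt * (1 / (1 - m ^ min (3 / 20 : ℝ) (εt / 4))) ≤ Q1) :
    IterationBounds N0 N1 N2 (fun e => ∑' j, Kj j e) E ε (εt / 4) lam D Q0 Q1 := by
  have hal : 0 ≤ |lam| := abs_nonneg lam
  have hC : 0 ≤ Qt * |lam| := mul_nonneg hQt hal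
  -- positivity of the geometric constants
  have hκ1 : 0 < min (1 / 5 : ℝ) (εt / 3) := lt_min (by norm_num) (by linarith)
  have hκ2 : 0 < min (3 / 20 : ℝ) (εt / 4) := lt_min (by norm_num) (by linarith)
  have hg1 : 0 ≤ 1 / (1 - m ^ min (1 / 5 : ℝ) (εt / 3)) :=
    div_nonneg zero_le_one (sub_nonneg.2 (Real.rpow_lt_one hm.le hm1 hκ1).le)
  have hg2 : 0 ≤ 1 / (1 - m ^ min (3 / 20 : ℝ) (εt / 4)) :=
    div_nonneg zero_le_one (sub_nonneg.2 (Real.rpow_lt_one hm.le hm1 hκ2).le)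
  -- `|f|₀ ≤ 1` on the ball (`ε ≤ 1/2`), whence `|f|₀^{ε̃/3} ≤ |f|₀^{ε̃/4}`
  have hsmall : ∀ e₀ e₁, N2 (e₀ - E) < ε → N2 (e₁ - E) < ε → N0 (e₁ - e₀) ≤ 1 := by
    intro e₀ e₁ h₀ h₁
    have : N2 (e₁ - e₀) ≤ N2 (e₁ - E) + N2 (e₀ - E) := by
      calc N2 (e₁ - e₀) = N2 ((e₁ - E) - (e₀ - E)) := by rw [sub_sub_sub_cancel_right]
        _ ≤ N2 (e₁ - E) + N2 (e₀ - E) := map_sub_le_add N2 _ _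
    have h02 : N0 (e₁ - e₀) ≤ N2 (e₁ - e₀) := (hN.le01 _).trans (hN.le12 _)
    linarith
  refine
    { delta_pos := by linarith
      delta_lt_one := by linarith
      one_le_D := hD1
      one_le_Q0 := hQ01
      one_le_Q1 := hQ11
      r1 := ?_
      dr0 := fun e₀ e₁ h₀ h₁ => (dr0 e₀ e₁ h₀ h₁).trans
        (mul_le_mul_of_nonneg_right (mul_le_mul_of_nonneg_right hQ0a hal) (apply_nonneg _ _))
      dr1 := ?_
      dr2 := ?_ }
  · -- (r1): "(line1) implies (r1) when summed over `j`" (p.9:L190-191)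
    intro e he
    have h := (norm_tsum_le_of_scale_bound hm hm1 hεt (line1 e he)).2
    calc ‖∑' j, Kj j e‖ ≤ Qt * |lam| * (m ^ εt / (1 - m ^ εt)) := h
      _ = Qt * (m ^ εt / (1 - m ^ εt)) * |lam| := by ring
      _ ≤ D * |lam| := mul_le_mul_of_nonneg_right hD hal
  · -- (dr1) with `δ = ε̃/4` via `ε̃/3` (p.9:L196-p.10:L25)
    intro e₀ e₁ h₀ h₁
    have h := (dr1_of_scale_bounds N0 N1 (fun x => (hN.le12 x).trans (hN.le2 x)) hm hm1 hεt hεt1 hC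
      (e₁ - e₀) (line1 e₁ h₁) (line1 e₀ h₀) (line3 e₀ e₁ h₀ h₁)).2.2
    have hy : 0 ≤ N0 (e₁ - e₀) := apply_nonneg _ _
    have hz : 0 ≤ N1 (e₁ - e₀) := apply_nonneg _ _
    have hexp : N0 (e₁ - e₀) ^ (εt / 3) ≤ N0 (e₁ - e₀) ^ (εt / 4) :=
      Real.rpow_le_rpow_of_exponent_ge' hy (hsmall e₀ e₁ h₀ h₁) (by linarith) (by linarith)
    have hyδ : 0 ≤ N0 (e₁ - e₀) ^ (εt / 4) := Real.rpow_nonneg hy _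
    calc N1 ((∑' j, Kj j e₁) - ∑' j, Kj j e₀)
        ≤ Qt * |lam| * (1 / (1 - m ^ min (1 / 5 : ℝ) (εt / 3))) *
            (3 * N0 (e₁ - e₀) ^ (εt / 3) + N1 (e₁ - e₀)) := h
      _ ≤ Qt * |lam| * (1 / (1 - m ^ min (1 / 5 : ℝ) (εt / 3))) *
            (3 * N0 (e₁ - e₀) ^ (εt / 4) + 3 * N1 (e₁ - e₀)) := by
          apply mul_le_mul_of_nonneg_left _ (mul_nonneg hC hg1)
          linarith
      _ = 3 * (Qt * (1 / (1 - m ^ min (1 / 5 : ℝ) (εt / 3)))) * |lam| *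
            (N0 (e₁ - e₀) ^ (εt / 4) + N1 (e₁ - e₀)) := by ring
      _ ≤ Q0 * |lam| * (N0 (e₁ - e₀) ^ (εt / 4) + N1 (e₁ - e₀)) := by
          apply mul_le_mul_of_nonneg_right (mul_le_mul_of_nonneg_right hQ0b hal)
          positivity
  · -- (dr2) = (eq35) with `δ = ε̃/4` (p.10:L27-90)
    intro e₀ e₁ S h₀ h₁ hS
    have hS0 : 0 ≤ S := by
      have := hS 0 (by simp)
      simp at this
      exact (norm_nonneg _).trans this
    have h := (dr2_of_scale_bounds N0 N1 N2 hm hm1 hεt hεt1 hC hS0 (e₁ - e₀) (line1 e₁ h₁)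
      (line1 e₀ h₀) (line4 e₀ e₁ S h₀ h₁ hS)).2.2
    have hy : 0 ≤ N1 (e₁ - e₀) := apply_nonneg _ _
    have hyδ : 0 ≤ N1 (e₁ - e₀) ^ (εt / 4) := Real.rpow_nonneg hy _
    have h0n : 0 ≤ N0 (e₁ - e₀) := apply_nonneg _ _
    have h2n : 0 ≤ N2 (e₁ - e₀) := apply_nonneg _ _
    set G : ℝ := Qt * (1 / (1 - m ^ min (3 / 20 : ℝ) (εt / 4))) with hG
    have hG0 : 0 ≤ G := mul_nonneg hQt hg2
    calc ‖(∑' j, Kj j e₁) - ∑' j, Kj j e₀‖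
        ≤ Qt * |lam| * (1 / (1 - m ^ min (3 / 20 : ℝ) (εt / 4))) *
            (3 * N1 (e₁ - e₀) ^ (εt / 4) + (S * N0 (e₁ - e₀) + N2 (e₁ - e₀))) := h
      _ = (3 * G) * |lam| * N1 (e₁ - e₀) ^ (εt / 4) + G * |lam| * N2 (e₁ - e₀) +
            G * |lam| * S * N0 (e₁ - e₀) := by rw [hG]; ring
      _ ≤ Q0 * |lam| * N1 (e₁ - e₀) ^ (εt / 4) + Q0 * |lam| * N2 (e₁ - e₀) +
            Q1 * |lam| * S * N0 (e₁ - e₀) := by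
          have hGQ0 : G ≤ Q0 := by linarith
          have t1 := mul_le_mul_of_nonneg_right (mul_le_mul_of_nonneg_right hQ0c hal) hyδ
          have t2 := mul_le_mul_of_nonneg_right (mul_le_mul_of_nonneg_right hGQ0 hal) h2n
          have t3 := mul_le_mul_of_nonneg_right
            (mul_le_mul_of_nonneg_right (mul_le_mul_of_nonneg_right hQ1 hal) hS0) h0n
          linarith
      _ = Q0 * |lam| * (N1 (e₁ - e₀) ^ (εt / 4) + N2 (e₁ - e₀)) + Q1 * |lam| * S * N0 (e₁ - e₀) := by
          ring

/-- **FST IV §3 for `K = Σ_j K_j`, end to end** (Theorem 3 + FST I Thm 3.5 ⇒ the conclusion of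
Theorem 2 (3), p.8:L48–67 with p.9:L186–p.10:L90): under the hypotheses of
`iterationBounds_of_scaleBounds` and "`Qλ_R < min{1,ε}`" with `Q = max{Q₀ + Q₁(1+G₃), D}`,
`G₃ ≥ |E|_{3,r}`, there is a unique `e ∈ 𝓔_R^E` with `E = e + Σ_j K_j(e)`, `|e − E|_{3,r} ≤ D|λ|`, and it is
the limit of the iteration `e_{n+1} = E − Σ_j K_j(e_n)`.
[cite: FeldmanSalmhoferTrubowitz2000, Thm 2 (3) with Thm 3 p.8:L48-67] -/
theorem deltasatz_existence_of_scaleBounds {N0 N1 N2 : Seminorm ℝ X} (hN : NormLadder N0 N1 N2)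
    {Kj : ℕ → X → X} {E : X} {ε m εt Qt lam Q00 D Q0 Q1 G₃ : ℝ}
    (hm : 0 < m) (hm1 : m < 1) (hεt : 0 < εt) (hεt1 : εt < 1) (hQt : 0 ≤ Qt) (hε : ε ≤ 1 / 2)
    (line1 : ∀ e, N2 (e - E) < ε → ∀ j, ‖Kj j e‖ ≤ Qt * |lam| * (m ^ εt) ^ (j + 1))
    (line3 : ∀ e₀ e₁, N2 (e₀ - E) < ε → N2 (e₁ - E) < ε → ∀ j,
      N1 (Kj j e₁ - Kj j e₀) ≤ Qt * |lam| *
        ((m ^ (-(11 / 10 : ℝ))) ^ (j + 1) * N0 (e₁ - e₀) + (m ^ εt) ^ (j + 1) * N1 (e₁ - e₀)))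
    (line4 : ∀ e₀ e₁ (S : ℝ), N2 (e₀ - E) < ε → N2 (e₁ - E) < ε →
      (∀ t ∈ Set.Icc (0 : ℝ) 1, ‖(1 - t) • e₀ + t • e₁‖ ≤ S) → ∀ j,
      ‖Kj j e₁ - Kj j e₀‖ ≤ Qt * |lam| *
        ((m ^ (-(21 / 10 : ℝ))) ^ (j + 1) * N1 (e₁ - e₀) +
          (m ^ εt) ^ (j + 1) * (S * N0 (e₁ - e₀) + N2 (e₁ - e₀))))
    (dr0 : ∀ e₀ e₁, N2 (e₀ - E) < ε → N2 (e₁ - E) < ε →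
      N0 ((∑' j, Kj j e₁) - ∑' j, Kj j e₀) ≤ Q00 * |lam| * N0 (e₁ - e₀))
    (hD1 : 1 ≤ D) (hD : Qt * (m ^ εt / (1 - m ^ εt)) ≤ D)
    (hQ01 : 1 ≤ Q0) (hQ0a : Q00 ≤ Q0)
    (hQ0b : 3 * (Qt * (1 / (1 - m ^ min (1 / 5 : ℝ) (εt / 3)))) ≤ Q0)
    (hQ0c : 3 * (Qt * (1 / (1 - m ^ min (3 / 20 : ℝ) (εt / 4)))) ≤ Q0)
    (hQ11 : 1 ≤ Q1) (hQ1 : Qt * (1 / (1 - m ^ min (3 / 20 : ℝ) (εt / 4))) ≤ Q1)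
    (hG : ‖E‖ ≤ G₃) (hq : bigQ Q0 Q1 D G₃ * |lam| < min 1 ε) :
    ∃ e, e ∈ ballE N2 E ε ∧ e + (∑' j, Kj j e) = E ∧ ‖e - E‖ ≤ D * |lam| ∧
      Tendsto (iter (fun e => ∑' j, Kj j e) E) atTop (𝓝 e) ∧
      ∀ e', e' ∈ ballE N2 E ε → e' + (∑' j, Kj j e') = E → e' = e :=
  deltasatz_existence (iterationBounds_of_scaleBounds hN hm hm1 hεt hεt1 hQt hε line1 line3 line4 dr0
    hD1 hD hQ01 hQ0a hQ0b hQ0c hQ11 hQ1) hN hG hq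

end FST4

end Literature.MathematicalPhysics.QuantumLattice.FermiRG
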